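import Summits.Ventures.QEDPrecision.Certificates.C2qTarget

/-!
# ΔM₄ target enclosure — the fourth-order finite magnetic-moment amplitude of the AHKN scheme to
`10⁻¹⁸` (venture QEDPrecision, cell `pub-qed`; the quantity integrand seat int-1 actually computes)

HONEST FRAMING (verbatim, venture QEDPrecision): independent recomputation; certified where stated,
statistical where stated; no new-physics claim.

In the Aoyama–Hayakawa–Kinoshita–Nio subtraction scheme the two-loop no-lepton-loop coefficient is
obtained from the finite amplitude `ΔM₄ = ΔM₄ₐ + ΔM₄_b` by the residual renormalisation
`a⁽⁴⁾[no lepton loops] = ΔM₄ − M₂·ΔB₂` with `M₂ = 1/2` (Schwinger) and `ΔB₂ = 3/4`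
(the cell's SCHEMES.md §C and int-1's VALIDATION.md §V3, checked against print by ref-2, REFEREE
round 9; AHKN print `ΔM₄ = 0.030 833 612…`, [arXiv:1412.8284] Table I cont.). Hence the exact
target of int-1's deterministic two-loop number is `ΔM₄ = c2qClosedForm + 3/8
= −25/16 + 5π²/12 − (π²/2) log 2 + (3/4) ζ(3) = 0.030833612561703532…`, enclosed here to `10⁻¹⁸`
directly from `c2qClosedForm_enclosure`. This types a TARGET; int-1's value of record
(`ΔM₄ = 0.030 833 611 5(6)`, VALIDATION.md) is a deterministic floating-point cubature and stays a
datum.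
-/

namespace Summit.Ventures.QEDPrecision.Certificates

open Real
open Literature.MathematicalPhysics.QuantumFieldTheory.LaportaRemiddi1996 (zeta)

/-- The exact value of the AHKN finite fourth-order amplitude `ΔM₄ = a⁽⁴⁾[no l.l.] + M₂ΔB₂
= c2qClosedForm + 3/8`. [cite: Petermann1957] [cite: Sommerfield1957] -/
noncomputable def deltaM4ClosedForm : ℝ := c2qClosedForm + 3 / 8

/-- `ΔM₄ = −25/16 + 5π²/12 − (π²/2) log 2 + (3/4) ζ(3)`. [folklore] -/
theorem deltaM4ClosedForm_eq :
    deltaM4ClosedForm = -25 / 16 + 5 * π ^ 2 / 12 - π ^ 2 / 2 * log 2 + 3 / 4 * zeta 3 := by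
  unfold deltaM4ClosedForm c2qClosedForm
  ring

/-- **ΔM₄ target enclosure (kernel-checked)**: `|ΔM₄ − 0.030833612561703533| ≤ 10⁻¹⁸`.
[cite: Petermann1957] [cite: Sommerfield1957] -/
theorem deltaM4ClosedForm_enclosure :
    Encloses deltaM4ClosedForm (30833612561703533 / 10 ^ 18) (1 / 10 ^ 18) := by
  have h := c2qClosedForm_enclosure
  unfold Encloses at h ⊢
  unfold deltaM4ClosedForm
  rw [abs_le] at h ⊢
  push_cast at h ⊢
  obtain ⟨h1, h2⟩ := h
  constructor
  · linarith
  · linarith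

end Summit.Ventures.QEDPrecision.Certificates
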